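import Literature.AlgebraicGeometry.Deformation.ObstructionClassWellDefined
import Literature.AlgebraicGeometry.Deformation.GenuineLiftCocycle
import Literature.AlgebraicGeometry.Modules.LocallyFreeTrace
import Mathlib.AlgebraicGeometry.Morphisms.Separated
import HarnessLib

/-!
# The Čech obstruction class of a module that lifts vanishes

Setting of `Deformation/ObstructionClassWellDefined.lean`: `j : Y ⟶ Z₀`, `i : Z₀ ⟶ Z₁` a
first-order thickening with `Z₁` separated, `eI : i_* j_* 𝒪_Y ≅ 𝓘`, an `𝒪_{Z₀}`-module `F`,
`E = j^*F`, and ANY framed lifting datum `(C, L)` of `F` by affine opens `U_a ⊆ Z₁` whose base opens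
cover `Y`. If `F ≅ i^*F'` for a finite locally free `𝒪_{Z₁}`-module `F'`, then the `Ext²(E, E)`-class
of the obstruction cocycle of `(C, L)` VANISHES (`classOf_obstruction_eq_zero_of_iso_pullback`):
by `Modules.exists_affine_framing` the module `F'` is framed over affine opens `U'_z ∋ z` of `Z₁`,
the genuine datum of `F` built from these frames has obstruction cocycle `0`
(`Deformation/GenuineLiftCocycle.lean`), and the class does not depend on the datum
(`classOf_obstruction_eq`). This is the necessity half of the lifting criterion of Hartshorne,
*Deformation Theory*, Thm. 7.1 for the class in Mathlib's `Ext`. Everything is proved; no named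
facts.

## References

* R. Hartshorne, *Deformation Theory*, GTM 257 (2010), §7, Thm. 7.1. [Hartshorne2010]
* The Stacks Project, Tag 01C6 (finite locally free modules). [StacksProject]
-/

noncomputable section

open CategoryTheory CategoryTheory.Abelian AlgebraicGeometry Opposite TopologicalSpace Limits

namespace Literature.AlgebraicGeometry.Modules

open Literature.AlgebraicGeometry.Motives

universe u

/-- **A finite locally free module is framed over affine opens `U_x ∋ x`** (point-indexed
framing: shrink the trivialising neighbourhoods to affine ones, affine opens being a basis).
[cite: StacksProject, Tag 01C6] -/
theorem exists_affine_framing {X : Scheme.{u}} {E : X.Modules} (hE : IsFiniteLocallyFree E) :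
    ∃ 𝔣 : Framing E X, (∀ x : X, x ∈ 𝔣.U x) ∧ ∀ x : X, IsAffineOpen (𝔣.U x) := by
  classical
  have key : ∀ x : X, ∃ U : X.Opens, IsAffineOpen U ∧ x ∈ U ∧ U ≤ trivNbhd hE x := fun x => by
    obtain ⟨U, hU, hxU, hle⟩ := Opens.isBasis_iff_nbhd.mp X.isBasis_affineOpens (mem_trivNbhd hE x)
    exact ⟨U, hU, hxU, hle⟩
  choose U hU hx hle using key
  let 𝔣 : Framing E X :=
    { U := U
      I := fun x => TrivIndex hE x
      e := fun x => SheafOfModules.restrictTrivialisation (R := X.ringCatSheaf) (homOfLE (hle x)) (trivFrame hE x) }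
  exact ⟨𝔣, hx, hU⟩

end Literature.AlgebraicGeometry.Modules

namespace Literature.AlgebraicGeometry.Deformation

open Literature.AlgebraicGeometry.Modules Literature.AlgebraicGeometry.Motives

universe u

variable {Y Z₀ Z₁ : Scheme.{u}} {j : Y ⟶ Z₀} {i : Z₀ ⟶ Z₁} {F : Z₀.Modules} {ι : Type u}

namespace FrameCover.Lifts

variable {C : FrameCover i F ι} (L : C.Lifts)
  (eI : (Scheme.Modules.pushforward i).obj ((Scheme.Modules.pushforward j).obj (unitModule Y)) ≅
    idealModule i)

/-- The base opens of a frame cover by opens `U_z ∋ z` (`z ∈ Z₁`) cover `Y`. [folklore] -/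
lemma iSup_baseFraming_U_eq_top_of_mem {C : FrameCover i F Z₁} (hU : ∀ z : Z₁, z ∈ C.U z) :
    iSup (C.baseFraming j).U = ⊤ :=
  top_le_iff.mp fun y _ => Opens.mem_iSup.mpr ⟨i.base (j.base y), hU _⟩

variable [IsFirstOrderThickening i] [HasExt.{u + 1} Y.Modules] [Z₁.IsSeparated]

/-- **A module that lifts has vanishing obstruction class**, for every framed lifting datum by
affine opens whose base opens cover `Y` (`Z₁` separated). [cite: Hartshorne2010, §7, Thm. 7.1] -/
theorem classOf_obstruction_eq_zero_of_iso_pullback (hUaff : ∀ a, IsAffineOpen (C.U a))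
    (hcovY : iSup (C.baseFraming j).U = ⊤) {F' : Z₁.Modules} (hF' : IsFiniteLocallyFree F')
    (φ : (Scheme.Modules.pullback i).obj F' ≅ F)
    (hω : Cech.dFamily ((C.baseFraming j).toLocalFamily (L.defectCochain eI)) = 0) :
    Cech.classOf (Cech.exactAugmentation (C.baseFraming j).U _ hcovY)
      ((C.baseFraming j).toLocalFamily (L.defectCochain eI)) hω = 0 := by
  obtain ⟨𝔣', hx, hUaff'⟩ := exists_affine_framing hF'
  have hcov' : iSup ((FrameCover.ofFraming (i := i) 𝔣' φ).baseFraming j).U = ⊤ :=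
    iSup_baseFraming_U_eq_top_of_mem hx
  have hW : ∀ p : ι × (Z₁ : Type u), IsAffineOpen (C.U p.1 ⊓ (FrameCover.ofFraming (i := i) 𝔣' φ).U p.2) :=
    fun p => (hUaff p.1).inf (hUaff' p.2)
  rw [← classOf_obstruction_eq L (Lifts.ofFraming (i := i) 𝔣' φ) eI hcovY hcov' hW hω
    (dFamily_toLocalFamily_defectCochain eI _),
    Cech.classOf_congr _ (toLocalFamily_defectCochain_ofFraming 𝔣' φ eI) _ (by
      rw [← toLocalFamily_defectCochain_ofFraming 𝔣' φ eI]; exact dFamily_toLocalFamily_defectCochain eI _)]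
  exact Cech.classOf_zero _ _

end FrameCover.Lifts

end Literature.AlgebraicGeometry.Deformation

end
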